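import Summits.BirchSwinnertonDyer.BirchSwinnertonDyer.Theorems.TwoAdicConverseMultLambdaRoad
import Literature.NumberTheory.EllipticCurves.Spiess2014.WeakExceptionalZero
import HarnessLib

/-!
# Route `TwoAdicConverse` (rung S3), multiplicative branch — the `⊗ℚ` lower-divisibility road (T-mult-4) and the
# λ-ROAD to `MultiplicativeRankZeroTwoConverse` (item stmt-BirchSwinnertonDyer-19219) RE-KEYED from the MEMO binder
# «Greenberg–Stevens at a split `2`» to the PRINTED weak exceptional-zero vanishing (Spieß 2014 Thm. 5.7)

Cell `bsd-2adic` (run/shared/lean/pub/bsd-2adic/), seat `bsd-2adic-conv-2` (GEN 9; director-bsd D-0074 (A): «19219 likewise; if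
found ⇒ S3 mult case»). THEOREMS ONLY — no definition, no named fact, nothing asserted, nothing booked; BSD is not proved by any
of this; item 19219 stays OPEN class-wide.

WHAT THIS FILE DOES. Two of the cell's S3ᵐ converse roads still display the MEMO binder `hGS : ∀ W split at 2, greenberg_stevens W 2`
(memo PROOF-GS2; in print `p` odd / `p ≥ 5`): the `⊗ℚ` LOWER-DIVISIBILITY road (T-mult-4: `multiplicativeRankZeroTwoConverse_of_multLowerRat`,
seat bsd-2adic-mult GEN 4, p411646, through the X5 door `X5.O1.analyticRank_eq_zero_of_finite_selmer_split_two`) and, on top of it,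
the μ-FREE λ-ROAD (`multiplicativeRankZeroTwoConverse_of_lambdaPart`, seat bsd-2adic-conv-2 GEN 0, p419187: Kato `⊗ℚ` K11 +
«`λ_an ≤ λ_alg`» ⇒ 19219 — the multiplicative analogue of the S3 good-ordinary served crux `OrdLambdaHalfAtTwo`, item 19556). As on the
WALL doors (seat bsd-2adic-mult-gs-c, `Theorems/TwoAdicConverseMultSplitWeakEZ.lean`, p462242) and on the admissible-twist road
(`Theorems/TwoAdicConverseMultTwistFamilyWeakEZ.lean`, GEN 9, p466547), `hGS` enters ONLY at the last step as
«`[T¹]L ≠ 0 ⇒ [0]⁺_f ≠ 0`», i.e. the contrapositive of the WEAK exceptional-zero vanishing, PRINTED at every prime — Spieß,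
Invent. Math. 196 (2014) Thm. 5.7 (`F = ℚ`, `r = 1`), tree named fact
`Literature.NumberTheory.EllipticCurves.Spiess2014.thm57_weakExceptionalZero_splitMultiplicative_rat W 2` (p456266). This file gives
the three twins with the PRINT binder `hW` in place of `hGS`:
* §1 `analyticRank_eq_zero_of_finite_selmer_split_two_of_weakEZ` — the X5 split door of the T-mult-4 road (proof = seat
  bsd-2adic-mult GEN 4's, verbatim up to the last step, credited);
* §2 `multiplicativeRankZeroTwoConverse_of_multLowerRat_of_weakEZ` — PRINT {A235, A236, modularity, Spieß} + MEMO {K11} + T-mult-4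
  `⊗ℚ` ∀-closed ⇒ 19219;
* §3 `multiplicativeRankZeroTwoConverse_of_lambdaPart_of_weakEZ` — PRINT {A235, A236, modularity, Spieß} + MEMO {K11} + the λ-part
  «`λ(2ⁿL₂) ≤ λ(f_X)`» ∀-closed ⇒ 19219.
AFTER THIS FILE every S3ᵐ rank-`0` converse road of the cell (walls / twist road / T-mult-4 / λ-road) has a Greenberg–Stevens-FREE
version; the only memo-grade input left on the converse side is Kato at a multiplicative `2` (K11 `⊗ℚ`; T-KATO2 at anchors).
PARTITION (D-0054): none — RANK axis (S3 mult, item 19219); companion formula cell X5@2 mult (K4ᵐ, B1·O1), whose split FORMULA doors keep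
the strong identity with `𝓛₂(E)`; owner bsd-2adic.

References: [Spiess2014Invent] Thm. 5.7, Rem. 5.11 (a); [GreenbergLNM1716] §4 pp. 112–113; [GreenbergVatsal2000] p. 4;
[MazurTateTeitelbaum1986Invent] §I.14–15, §II; [Kato2004Asterisque] Thm. 17.4, 17.13.
-/

set_option linter.dupNamespace false
set_option autoImplicit false

noncomputable section

open scoped Classical MatrixGroups ModularForm

open CongruenceSubgroup WeierstrassCurve Literature.NumberTheory.EllipticCurves
  Literature.NumberTheory.EllipticCurves.ModularForms
  Literature.NumberTheory.EllipticCurves.Greenberg1999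
  Literature.NumberTheory.EllipticCurves.Rank1Residual
  Literature.NumberTheory.EllipticCurves.Rank1Residual.Typed
  Literature.NumberTheory.EllipticCurves.Spiess2014
  Summit.BirchSwinnertonDyer.Rank1Residual.X1.MuLambda
  Summit.BirchSwinnertonDyer.Rank1Residual.X5
  Summit.BirchSwinnertonDyer.Rank1Residual.X5.O1

namespace Summit.BirchSwinnertonDyer.BirchSwinnertonDyer.Theorems

/-! ## §1 The X5 split door of the T-mult-4 road, weak-EZ keyed -/

/-- **Rank-`0` `2`-converse at a SPLIT `2` from T-mult-4, weak-EZ keyed (PROVED modulo the displayed inputs).** Twin of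
`X5.O1.analyticRank_eq_zero_of_finite_selmer_split_two` (seat bsd-2adic-mult GEN 4) with `hW : Spiess2014.thm57_…_rat W 2` (PRINT) in
place of `hGS : greenberg_stevens W 2` (MEMO): A236 `h41`, modularity `hmod`, K11b-Rat `hK` (for «`X` torsion»), the lower `⊗ℚ`
divisibility `hlow'` (T-mult-4, split clause `2ⁿ·ι(T·f_E) = ι(h)·L`); `Sel_{2^∞}(E/ℚ)` finite ⇒ `f_E(0) ≠ 0` (Greenberg's split display)
⇒ `[T¹]L ≠ 0` ⇒ (Spieß, contrapositive) `[0]⁺_f ≠ 0` ⇒ `L(E,1) ≠ 0 ∧ r_an(E) = 0`.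
[cite: Spiess2014Invent, Thm. 5.7 (F = ℚ, r = 1)] [cite: GreenbergLNM1716, §4 pp. 112–113] [cite: MazurTateTeitelbaum1986Invent, §I.15] -/
theorem analyticRank_eq_zero_of_finite_selmer_split_two_of_weakEZ
    (W : WeierstrassCurve ℚ) [W.IsElliptic] [W.IsGloballyMinimal]
    (hW : thm57_weakExceptionalZero_splitMultiplicative_rat W 2)
    (h41 : thm41Analogue_charValue_rankZero_split_baseChange_anyPrime)
    (hmod : nonempty_modularParametrizationData)
    (hK : ∀ [NeZero (W.conductorNorm ℤ)] (f : CuspForm (Gamma0 (W.conductorNorm ℤ)) 2)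
      (L : PowerSeries ℚ_[2]), KatoDivisibilityAtTwoSplitMultRat W f L)
    (hlow' : MultLowerDivisibilityAtTwoRat W)
    (hmult : Mult W 2) (hsp : W.HasSplitMultiplicativeReductionAtPrime 2)
    (hfin : Finite (W.selmerGroupPInfty 2)) :
    W.entireLFunction 1 ≠ 0 ∧ W.analyticRank = 0 := by
  haveI : NeZero (W.conductorNorm ℤ) := ⟨(W.conductorNorm_pos_holds).ne'⟩
  obtain ⟨Dm⟩ := hmod W
  have hf : IsNewformOf W Dm.f := Dm.isNewformOf
  obtain ⟨κ, hκ, γ, hγ, hγ'⟩ := exists_isCyclotomic_isTopGenerator_isCyclotomicVariable_holds 2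
  obtain ⟨D⟩ := W.nonempty_selmerDualData_holds κ γ hγ
  obtain ⟨L, hL⟩ := exists_isSplitMultPAdicLFunctionOf hsp hf
  obtain ⟨Dq⟩ := (nonempty_tateParameterData_iff_holds (W := W) (p := 2)).mpr hsp
  have hlog : padicLog 2 Dq.q ≠ 0 := Dq.padicLog_q_ne_zero Literature.NumberTheory.Transcendental.MahlerManinPadic_holds
  obtain ⟨hX, -⟩ := hK Dm.f L κ γ hκ hγ hγ' hmult hsp hf hL D
  haveI : Module.Finite (IwasawaAlgebra 2) D.X := D.module_finite_holds hγ
  haveI : (Module.charIdeal (IwasawaAlgebra 2) D.X).IsPrincipal := charIdeal_isPrincipal_holds 2 D.X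
  obtain ⟨fE, hchar⟩ := Submodule.IsPrincipal.principal (Module.charIdeal (IwasawaAlgebra 2) D.X)
  have hchar' : D.charIdeal = Ideal.span {fE} := hchar
  -- Greenberg's split display at `2` (A236): `f_E(0) ≠ 0` since `Sel` is finite
  have hEC : TwoAdicEulerCharRankZeroSplitMult W 0 :=
    twoAdicEulerCharRankZeroSplitMult_zero_of_greenberg W h41
  obtain ⟨u, hu⟩ := hEC hmult hsp κ γ hκ hγ hγ' D hX fE hchar' hfin Dq hlog
  have hcard : (Nat.card (W.selmerGroupPInfty 2) : ℚ_[2]) ≠ 0 := by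
    haveI := hfin
    exact_mod_cast (Nat.card_pos (α := W.selmerGroupPInfty 2)).ne'
  have hLI0 : LInvariant Dq ≠ 0 := lInvariant_two_ne_zero W Dq
  have hfE0 : ((PowerSeries.constantCoeff fE : ℤ_[2]) : ℚ_[2]) ≠ 0 := by
    intro h0
    rw [h0, zero_mul] at hu
    refine (mul_ne_zero (mul_ne_zero (mul_ne_zero (coe_units_ne_zero 2 u) ?_)
      (zpow_ne_zero _ two_ne_zero)) hcard) hu.symm
    exact div_ne_zero hLI0 (by norm_num)
  -- T-mult-4, split clause: `2ⁿ · ι(T f_E) = ι h · L`; coefficient of `T¹` (`L(0) = 0`)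
  obtain ⟨-, hsp'⟩ := hlow' κ γ hκ hγ hγ' hmult Dm.f hf D fE hchar'
  obtain ⟨n, h, hdiv⟩ := hsp' hsp L hL
  have h1 := congrArg (PowerSeries.coeff 1) hdiv
  rw [PowerSeries.coeff_C_mul, coeff_one_iwasawaToPowerSeries_X_mul, PowerSeries.coeff_mul,
    Finset.Nat.sum_antidiagonal_eq_sum_range_succ_mk, Finset.sum_range_succ,
    Finset.sum_range_succ, Finset.sum_range_zero, zero_add,
    PowerSeries.coeff_zero_eq_constantCoeff_apply L, hL.constantCoeff_eq_zero, mul_zero, add_zero,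
    PowerSeries.coeff_zero_eq_constantCoeff_apply] at h1
  -- `2ⁿ · f_E(0) = h(0) · [T¹]L`, so `[T¹]L ≠ 0`
  have hc1 : PowerSeries.coeff 1 L ≠ 0 := by
    intro hz
    rw [hz, mul_zero] at h1
    exact (mul_ne_zero (pow_ne_zero n two_ne_zero) hfE0) h1
  -- the ONLY change w.r.t. the Greenberg–Stevens-keyed original: Spieß Thm. 5.7 (weak EZ vanishing), contrapositive
  have hs0' : ratPlusSymbol Dm.f 0 ≠ 0 := hW.ratPlusSymbol_zero_ne_zero Dq hf hL hc1
  have hL1 : W.entireLFunction 1 ≠ 0 := (ratPlusSymbol_zero_ne_zero_iff W hf).mp hs0'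
  exact ⟨hL1, (W.analyticRank_eq_zero_iff_holds hf.hasEntireLFunction).mpr hL1⟩

/-! ## §2 The T-mult-4 bridge to the crux, weak-EZ keyed -/

/-- **Bridge (T-mult-4 `⊗ℚ` road ⇒ crux 19219), weak-EZ keyed.** Twin of `multiplicativeRankZeroTwoConverse_of_multLowerRat`
(seat bsd-2adic-mult GEN 4, p411646): PRINT {A235 `h41ns`, A236 `h41sp`, modularity `hmod`, Spieß Thm. 5.7 at every split-at-`2` curve `hW`}
+ MEMO {Kato `⊗ℚ` at a multiplicative `2` `hKato` (K11), ∀ non-CM `E` multiplicative at `2`} + the OPEN lower `⊗ℚ` divisibility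
T-mult-4 (`hlow'`, ∀-closed) ⟹ `MultiplicativeRankZeroTwoConverse`. No Greenberg–Stevens binder.
[cite: Spiess2014Invent, Thm. 5.7 (F = ℚ, r = 1)] [cite: GreenbergLNM1716, §4 pp. 112–113] [cite: MazurTateTeitelbaum1986Invent, §I.14]
[cite: Kato2004Asterisque, Thm 17.4 and 17.13] -/
theorem multiplicativeRankZeroTwoConverse_of_multLowerRat_of_weakEZ
    (h41ns : thm41Analogue_charValue_rankZero_numberField_anyPrime)
    (h41sp : thm41Analogue_charValue_rankZero_split_baseChange_anyPrime)
    (hmod : nonempty_modularParametrizationData)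
    (hKato : ∀ (W : WeierstrassCurve ℚ) [W.IsElliptic] [W.IsGloballyMinimal],
      ¬ W.HasCM → Mult W 2 → O1.KatoMultiplicativeDivisibilityRat W 2)
    (hW : ∀ (W : WeierstrassCurve ℚ) [W.IsElliptic] [W.IsGloballyMinimal],
      W.HasSplitMultiplicativeReductionAtPrime 2 → thm57_weakExceptionalZero_splitMultiplicative_rat W 2)
    (hlow' : ∀ (W : WeierstrassCurve ℚ) [W.IsElliptic] [W.IsGloballyMinimal],
      ¬ W.HasCM → Mult W 2 → O1.MultLowerDivisibilityAtTwoRat W) :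
    Summit.BirchSwinnertonDyer.BirchSwinnertonDyer.Theses.TwoAdicConverse.MultiplicativeRankZeroTwoConverse := by
  unfold Summit.BirchSwinnertonDyer.BirchSwinnertonDyer.Theses.TwoAdicConverse.MultiplicativeRankZeroTwoConverse
  intro W _ _ hcm hmult hsel
  haveI : Fact (Nat.Prime 2) := ⟨Nat.prime_two⟩
  have hfin : Finite (W.selmerGroupPInfty 2) :=
    (finite_selmerGroupPInfty_iff_selmerCorank_eq_zero W 2).mpr hsel
  by_cases hsp : W.HasSplitMultiplicativeReductionAtPrime 2
  · exact (analyticRank_eq_zero_of_finite_selmer_split_two_of_weakEZ W (hW W hsp) h41sp hmod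
      (fun f L => O1.katoDivisibilityAtTwoSplitMultRat_of_multRat W (hKato W hcm hmult) f L)
      (hlow' W hcm hmult) hmult hsp hfin).2
  · exact (O1.analyticRank_eq_zero_of_finite_selmer_nonsplit_two W h41ns hmod
      (fun f L => O1.katoDivisibilityAtTwoNonsplitMultRat_of_multRat W (hKato W hcm hmult) f L)
      (hlow' W hcm hmult) hmult hsp hfin).2

/-! ## §3 The μ-free λ-road to the crux, weak-EZ keyed -/

/-- **Bridge (λ-road ⇒ crux 19219), weak-EZ keyed.** Twin of `multiplicativeRankZeroTwoConverse_of_lambdaPart` (seat bsd-2adic-conv-2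
GEN 0, p419187): PRINT {A235 `h41ns`, A236 `h41sp`, modularity `hmod`, Spieß Thm. 5.7 `hW`} + MEMO {K11 `hKato`} + the λ-PART ∀-closed over
non-CM `E/ℚ` multiplicative at `2` (`hlam`: «`λ(2ⁿ·L₂(E)) ≤ λ(char X(E/ℚ_∞))`, trivial zero removed») ⟹ `MultiplicativeRankZeroTwoConverse`.
NO `μ`-hypothesis, NO period integrality, NO `BSD₂`, NO Greenberg–Stevens: the multiplicative analogue, now memo-light, of the S3
good-ordinary glue over the served crux `OrdLambdaHalfAtTwo` (item 19556). Composition: `multLowerDivisibilityAtTwoRat_of_katoRat_of_lambdaPart`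
(GEN 0, pure algebra on K11) then §2. [cite: GreenbergVatsal2000, p. 4 (after Thm. (1.2))] [cite: Spiess2014Invent, Thm. 5.7 (F = ℚ, r = 1)]
[cite: GreenbergLNM1716, §4 pp. 112–113] [cite: Kato2004Asterisque, Thm 17.4 and 17.13] -/
theorem multiplicativeRankZeroTwoConverse_of_lambdaPart_of_weakEZ
    (h41ns : thm41Analogue_charValue_rankZero_numberField_anyPrime)
    (h41sp : thm41Analogue_charValue_rankZero_split_baseChange_anyPrime)
    (hmod : nonempty_modularParametrizationData)
    (hKato : ∀ (W : WeierstrassCurve ℚ) [W.IsElliptic] [W.IsGloballyMinimal],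
      ¬ W.HasCM → Mult W 2 → O1.KatoMultiplicativeDivisibilityRat W 2)
    (hW : ∀ (W : WeierstrassCurve ℚ) [W.IsElliptic] [W.IsGloballyMinimal],
      W.HasSplitMultiplicativeReductionAtPrime 2 → thm57_weakExceptionalZero_splitMultiplicative_rat W 2)
    (hlam : ∀ (W : WeierstrassCurve ℚ) [W.IsElliptic] [W.IsGloballyMinimal], ¬ W.HasCM → Mult W 2 →
      ∀ (κ : ZpExtension ℚ 2) (γ : Field.absoluteGaloisGroup ℚ), κ.IsCyclotomic →
      κ.IsTopGenerator γ → IsCyclotomicVariable 2 γ → Mult W 2 →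
      ∀ ⦃N : ℕ⦄ [NeZero N] (f : CuspForm (Gamma0 N) 2), IsNewformOf W f →
      ∀ (D : W.SelmerDualData κ γ) (g h : IwasawaAlgebra 2) (n : ℕ),
        D.charIdeal = Ideal.span {g} →
        (¬ W.HasSplitMultiplicativeReductionAtPrime 2 →
          ∀ L : PowerSeries ℚ_[2], IsMultPAdicLFunctionOf f 2 (-1) L →
            iwasawaToPowerSeries 2 (g * h) = PowerSeries.C ((2 : ℚ_[2]) ^ n) * L →
            g * h ≠ 0 ∧ lam (g * h) ≤ lam g) ∧
        (W.HasSplitMultiplicativeReductionAtPrime 2 →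
          ∀ L : PowerSeries ℚ_[2], IsSplitMultPAdicLFunctionOf f 2 L →
            iwasawaToPowerSeries 2 (PowerSeries.X * (g * h)) = PowerSeries.C ((2 : ℚ_[2]) ^ n) * L →
            g * h ≠ 0 ∧ lam (g * h) ≤ lam g)) :
    Summit.BirchSwinnertonDyer.BirchSwinnertonDyer.Theses.TwoAdicConverse.MultiplicativeRankZeroTwoConverse :=
  multiplicativeRankZeroTwoConverse_of_multLowerRat_of_weakEZ h41ns h41sp hmod hKato hW
    (fun W _ _ hcm hmult =>
      multLowerDivisibilityAtTwoRat_of_katoRat_of_lambdaPart W (hKato W hcm hmult) (hlam W hcm hmult))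

end Summit.BirchSwinnertonDyer.BirchSwinnertonDyer.Theorems
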